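import Summits.CriticalPhenomena.PercolationContinuityZ3.Theorems.PercNearOneGluingNoHeavyQuantLightTwoBlobFlow
import Summits.CriticalPhenomena.PercolationContinuityZ3.Theorems.PercNearOneGluingNoHeavyQuantTwoBlobZeroFlow
import Summits.CriticalPhenomena.PercolationContinuityZ3.Theorems.PercNearOneGluingNoHeavyQuantLightLightTwoBlobPolyA
import Summits.CriticalPhenomena.PercolationContinuityZ3.Theorems.PercNearOneGluingNoHeavyQuantLightLightTwoBlobPolyB
import Summits.CriticalPhenomena.PercolationContinuityZ3.Theorems.PercNearOneGluingNoHeavyQuantLightLightTwoBlobPolyC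
import Summits.CriticalPhenomena.PercolationContinuityZ3.Theorems.PercNearOneGluingNoHeavyQuantLightLightTwoBlobPolyD
import HarnessLib

/-!
# QUANT lane R8, T-DEC: the LIGHT–LIGHT two-blob law — part 2b: the cell inequalities (sub-case Z) in `usage` form

builds on p205010 (kernel theorem, internal audit signed; external expert review pending)

Support file (`--supports stmt-CriticalPhenomena-4575`), QUANT lane typer seat prim-quant-stmt (gen 23), rung R8 of
`run/shared/lean/prim/quant/LADDER.md`.  Theorems only, standard axioms, no sorries.

With `κᵢ = (γᵢ − x²)/(1 − x)`, `T = bκ₁ + aκ₂`: `cap_O_<sb><sa>` — sub-case O (only atom `0` low), the CAPACITY INEQUALITY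
`(1−γ₁)(1−γ₂) ≤ C_b + C_a + γ₁γ₂/usage(0, b+a)` (`C_h` the closed-form capacity `m_h/usage(0,h)` of the mid `h` when `T < h`, else `0`;
status of `(0,b)`, `(0,a)` ∈ {inc, H, L}) in the shape of `LawDec.twoBlob_decAtT_of_capacity` (`…QuantTwoBlobZeroFlow`); `top_Z_<sa>` —
sub-case Z (`2b < T`), the top inequality of `LawDec.twoBlob_decAtT_of_lowFlow` (`…QuantLightTwoBlobFlow`) with `F` = the capacity of `a`.
Each: closed-form usage (`usage0_eq_light/heavy`, `usage_eq_light'`), positive denominators cleared, polynomial certificate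
`LightLightCert.poly_*` (`…QuantLightLightTwoBlobPoly{A,B,C,D}`).

[this work]; the gluing rows served [cite: KozmaNitzan2024, Conjecture 3 (p. 15)]; product measure [cite: Grimmett1999, §1.3 p. 10].
-/

noncomputable section

namespace Summit.CriticalPhenomena.PercolationContinuityZ3.Theorems

namespace Quant

open Finset

namespace LawDec

/-- **light–light top inequality, cell Z_inc** (b low; (0,a): inc). [this work] -/
theorem top_Z_inc (x κ₁ κ₂ : ℝ) (a b j'' : ℕ) (hx0 : 0 < x) (hx1 : x < 1) (hk0 : 0 < κ₁) (hkx : κ₁ < x) (hk20 : 0 < κ₂) (hk2x : κ₂ < x)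
    (ha : 1 ≤ a) (hb : 1 ≤ b) (hj : a + b ≤ j'')
    (h2b : 2 * (b : ℝ) < ((b : ℝ) * κ₁ + (a : ℝ) * κ₂)) (hTa : (a : ℝ) ≤ ((b : ℝ) * κ₁ + (a : ℝ) * κ₂)) :
    usage x ((b : ℝ) * κ₁ + (a : ℝ) * κ₂) j'' b (b + a) * ((x ^ 2 + (1 - x) * κ₁) * (1 - (x ^ 2 + (1 - x) * κ₂)))
      + usage x ((b : ℝ) * κ₁ + (a : ℝ) * κ₂) j'' 0 (b + a) * (((1 - (x ^ 2 + (1 - x) * κ₁)) * (1 - (x ^ 2 + (1 - x) * κ₂))) - 0)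
      ≤ ((x ^ 2 + (1 - x) * κ₁) * (x ^ 2 + (1 - x) * κ₂)) := by
  have ha0 : (0 : ℝ) < (a : ℝ) := by exact_mod_cast Nat.lt_of_lt_of_le Nat.zero_lt_one ha
  have hb0 : (0 : ℝ) < (b : ℝ) := by exact_mod_cast Nat.lt_of_lt_of_le Nat.zero_lt_one hb
  have hG1 : 0 < x ^ 2 + (1 - x) * κ₁ := by nlinarith [mul_pos (sub_pos.2 hx1) hk0, pow_pos hx0 2]
  have hG1' : x ^ 2 + (1 - x) * κ₁ < 1 := by nlinarith [mul_lt_mul_of_pos_left hkx (sub_pos.2 hx1)]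
  have hG2 : 0 < x ^ 2 + (1 - x) * κ₂ := by nlinarith [mul_pos (sub_pos.2 hx1) hk20, pow_pos hx0 2]
  have hG2' : x ^ 2 + (1 - x) * κ₂ < 1 := by nlinarith [mul_lt_mul_of_pos_left hk2x (sub_pos.2 hx1)]
  have hT0 : 0 < (b : ℝ) * κ₁ + (a : ℝ) * κ₂ := by nlinarith [mul_pos hb0 hk0, mul_pos ha0 hk20]
  have hsT : (b : ℝ) * κ₁ + (a : ℝ) * κ₂ < (b : ℝ) + (a : ℝ) := by
    nlinarith [mul_pos hb0 (sub_pos.2 (hkx.trans hx1)), mul_pos ha0 (sub_pos.2 (hk2x.trans hx1))]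
  have hL0n : (b : ℝ) * κ₁ + (a : ℝ) * κ₂ ≤ x * ((a : ℝ) + (b : ℝ)) := by
    nlinarith [mul_le_mul_of_nonneg_left hkx.le hb0.le, mul_le_mul_of_nonneg_left hk2x.le ha0.le]
  have hL0 : (b : ℝ) * κ₁ + (a : ℝ) * κ₂ ≤ x * ((b + a : ℕ) : ℝ) := by push_cast; linarith
  have hbaj : b + a ≤ j'' := by omega
  have hd0 : (0:ℝ) < (1 - x) * ((1 + x) * ((b : ℝ) + (a : ℝ)) - ((b : ℝ) * κ₁ + (a : ℝ) * κ₂)) := by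
    apply mul_pos (sub_pos.2 hx1); nlinarith [mul_nonneg hx0.le (by linarith : (0:ℝ) ≤ (b : ℝ) + (a : ℝ))]
  have hL1n : (b : ℝ) * κ₁ + (a : ℝ) * κ₂ - 2 * (b : ℝ) ≤ x * (a : ℝ) := by
    nlinarith [mul_le_mul_of_nonneg_left hk2x.le ha0.le, mul_nonneg hb0.le (by linarith : (0:ℝ) ≤ 2 - κ₁)]
  have hL1 : (b : ℝ) * κ₁ + (a : ℝ) * κ₂ - 2 * (b : ℝ) ≤ x * (((b + a : ℕ) : ℝ) - (b : ℝ)) := by push_cast; linarith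
  rw [usage_eq_light' x _ j'' b (b + a) hx0 hx1 hbaj h2b (by push_cast; linarith) hL1,
    usage0_eq_light x _ j'' (b + a) hx0 hx1 hbaj hT0 (by push_cast; linarith) hL0]
  push_cast
  have hd1 : (0:ℝ) < (1 - x) * ((1 - x) * (b : ℝ) + (1 + x) * ((b : ℝ) + (a : ℝ)) - ((b : ℝ) * κ₁ + (a : ℝ) * κ₂)) := by
    apply mul_pos (sub_pos.2 hx1); nlinarith [mul_nonneg hx0.le (by linarith : (0:ℝ) ≤ (b : ℝ) + (a : ℝ))]
  have hn1 : (0:ℝ) ≤ x ^ 2 * (a : ℝ) + (1 - x) * ((b : ℝ) * κ₁ + (a : ℝ) * κ₂ - 2 * (b : ℝ)) := by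
    nlinarith [mul_nonneg (pow_nonneg hx0.le 2) ha0.le, mul_nonneg (sub_nonneg.2 hx1.le) (sub_nonneg.2 h2b.le)]
  have key := LightLightCert.poly_Z_inc x κ₁ κ₂ a b hb0.le hx0.le (by linarith) hk0.le (by linarith) hk20.le (by linarith) (by linarith [hG1.le]) (by linarith [hG2.le]) (by linarith) (by linarith) ha0.le (by linarith [h2b]) (by linarith [hL1n]) (by linarith [hL0n]) (by linarith [hTa]) (by linarith [hT0.le]) (by linarith [hsT]) (by linarith [hd1.le]) (by linarith [hd0.le]) (by linarith [hn1])
  rw [sub_zero, div_mul_eq_mul_div, div_mul_eq_mul_div, div_add_div _ _ hd1.ne' hd0.ne', div_le_iff₀ (mul_pos hd1 hd0)]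
  linarith [mul_nonneg (sub_nonneg.2 hx1.le) (mul_nonneg (sub_nonneg.2 hx1.le) (key))]

/-- **light–light top inequality, cell Z_H** (b low; (0,a): H). [this work] -/
theorem top_Z_H (x κ₁ κ₂ : ℝ) (a b j'' : ℕ) (hx0 : 0 < x) (hx1 : x < 1) (hk0 : 0 < κ₁) (hkx : κ₁ < x) (hk20 : 0 < κ₂) (hk2x : κ₂ < x)
    (ha : 1 ≤ a) (hb : 1 ≤ b) (hj : a + b ≤ j'')
    (h2b : 2 * (b : ℝ) < ((b : ℝ) * κ₁ + (a : ℝ) * κ₂)) (_hTa : ((b : ℝ) * κ₁ + (a : ℝ) * κ₂) < (a : ℝ)) (_hHa : x * (a : ℝ) ≤ ((b : ℝ) * κ₁ + (a : ℝ) * κ₂)) :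
    usage x ((b : ℝ) * κ₁ + (a : ℝ) * κ₂) j'' b (b + a) * ((x ^ 2 + (1 - x) * κ₁) * (1 - (x ^ 2 + (1 - x) * κ₂)))
      + usage x ((b : ℝ) * κ₁ + (a : ℝ) * κ₂) j'' 0 (b + a) * (((1 - (x ^ 2 + (1 - x) * κ₁)) * (1 - (x ^ 2 + (1 - x) * κ₂))) - ((1 - (x ^ 2 + (1 - x) * κ₁)) * (x ^ 2 + (1 - x) * κ₂)) * ((a : ℝ) - ((b : ℝ) * κ₁ + (a : ℝ) * κ₂)) / ((b : ℝ) * κ₁ + (a : ℝ) * κ₂))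
      ≤ ((x ^ 2 + (1 - x) * κ₁) * (x ^ 2 + (1 - x) * κ₂)) := by
  have ha0 : (0 : ℝ) < (a : ℝ) := by exact_mod_cast Nat.lt_of_lt_of_le Nat.zero_lt_one ha
  have hb0 : (0 : ℝ) < (b : ℝ) := by exact_mod_cast Nat.lt_of_lt_of_le Nat.zero_lt_one hb
  have hG1 : 0 < x ^ 2 + (1 - x) * κ₁ := by nlinarith [mul_pos (sub_pos.2 hx1) hk0, pow_pos hx0 2]
  have hG1' : x ^ 2 + (1 - x) * κ₁ < 1 := by nlinarith [mul_lt_mul_of_pos_left hkx (sub_pos.2 hx1)]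
  have hG2 : 0 < x ^ 2 + (1 - x) * κ₂ := by nlinarith [mul_pos (sub_pos.2 hx1) hk20, pow_pos hx0 2]
  have hG2' : x ^ 2 + (1 - x) * κ₂ < 1 := by nlinarith [mul_lt_mul_of_pos_left hk2x (sub_pos.2 hx1)]
  have hT0 : 0 < (b : ℝ) * κ₁ + (a : ℝ) * κ₂ := by nlinarith [mul_pos hb0 hk0, mul_pos ha0 hk20]
  have hsT : (b : ℝ) * κ₁ + (a : ℝ) * κ₂ < (b : ℝ) + (a : ℝ) := by
    nlinarith [mul_pos hb0 (sub_pos.2 (hkx.trans hx1)), mul_pos ha0 (sub_pos.2 (hk2x.trans hx1))]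
  have hL0n : (b : ℝ) * κ₁ + (a : ℝ) * κ₂ ≤ x * ((a : ℝ) + (b : ℝ)) := by
    nlinarith [mul_le_mul_of_nonneg_left hkx.le hb0.le, mul_le_mul_of_nonneg_left hk2x.le ha0.le]
  have hL0 : (b : ℝ) * κ₁ + (a : ℝ) * κ₂ ≤ x * ((b + a : ℕ) : ℝ) := by push_cast; linarith
  have hbaj : b + a ≤ j'' := by omega
  have hd0 : (0:ℝ) < (1 - x) * ((1 + x) * ((b : ℝ) + (a : ℝ)) - ((b : ℝ) * κ₁ + (a : ℝ) * κ₂)) := by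
    apply mul_pos (sub_pos.2 hx1); nlinarith [mul_nonneg hx0.le (by linarith : (0:ℝ) ≤ (b : ℝ) + (a : ℝ))]
  have hL1n : (b : ℝ) * κ₁ + (a : ℝ) * κ₂ - 2 * (b : ℝ) ≤ x * (a : ℝ) := by
    nlinarith [mul_le_mul_of_nonneg_left hk2x.le ha0.le, mul_nonneg hb0.le (by linarith : (0:ℝ) ≤ 2 - κ₁)]
  have hL1 : (b : ℝ) * κ₁ + (a : ℝ) * κ₂ - 2 * (b : ℝ) ≤ x * (((b + a : ℕ) : ℝ) - (b : ℝ)) := by push_cast; linarith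
  rw [usage_eq_light' x _ j'' b (b + a) hx0 hx1 hbaj h2b (by push_cast; linarith) hL1,
    usage0_eq_light x _ j'' (b + a) hx0 hx1 hbaj hT0 (by push_cast; linarith) hL0]
  push_cast
  have hd1 : (0:ℝ) < (1 - x) * ((1 - x) * (b : ℝ) + (1 + x) * ((b : ℝ) + (a : ℝ)) - ((b : ℝ) * κ₁ + (a : ℝ) * κ₂)) := by
    apply mul_pos (sub_pos.2 hx1); nlinarith [mul_nonneg hx0.le (by linarith : (0:ℝ) ≤ (b : ℝ) + (a : ℝ))]
  have hn1 : (0:ℝ) ≤ x ^ 2 * (a : ℝ) + (1 - x) * ((b : ℝ) * κ₁ + (a : ℝ) * κ₂ - 2 * (b : ℝ)) := by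
    nlinarith [mul_nonneg (pow_nonneg hx0.le 2) ha0.le, mul_nonneg (sub_nonneg.2 hx1.le) (sub_nonneg.2 h2b.le)]
  have key := LightLightCert.poly_Z_H x κ₁ κ₂ a b ha0.le hb0.le (by linarith) (by linarith) (by linarith [hG1.le]) (by linarith) (by linarith) (by linarith [hG2.le]) (by linarith) hk0.le hk20.le hx0.le
  rw [div_mul_eq_mul_div, sub_div' hT0.ne', div_mul_div_comm, div_add_div _ _ hd1.ne' (mul_ne_zero hd0.ne' hT0.ne'),
    div_le_iff₀ (mul_pos hd1 (mul_pos hd0 hT0))]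
  linarith [mul_nonneg (sub_nonneg.2 hx1.le) (mul_nonneg (sub_nonneg.2 hx1.le) (mul_nonneg ha0.le (key)))]

/-- **light–light top inequality, cell Z_L** (b low; (0,a): L). [this work] -/
theorem top_Z_L (x κ₁ κ₂ : ℝ) (a b j'' : ℕ) (hx0 : 0 < x) (hx1 : x < 1) (hk0 : 0 < κ₁) (hkx : κ₁ < x) (hk20 : 0 < κ₂) (hk2x : κ₂ < x)
    (ha : 1 ≤ a) (hb : 1 ≤ b) (hj : a + b ≤ j'')
    (h2b : 2 * (b : ℝ) < ((b : ℝ) * κ₁ + (a : ℝ) * κ₂)) (_hTa : ((b : ℝ) * κ₁ + (a : ℝ) * κ₂) < (a : ℝ)) (_hLa : ((b : ℝ) * κ₁ + (a : ℝ) * κ₂) ≤ x * (a : ℝ)) :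
    usage x ((b : ℝ) * κ₁ + (a : ℝ) * κ₂) j'' b (b + a) * ((x ^ 2 + (1 - x) * κ₁) * (1 - (x ^ 2 + (1 - x) * κ₂)))
      + usage x ((b : ℝ) * κ₁ + (a : ℝ) * κ₂) j'' 0 (b + a) * (((1 - (x ^ 2 + (1 - x) * κ₁)) * (1 - (x ^ 2 + (1 - x) * κ₂))) - ((1 - (x ^ 2 + (1 - x) * κ₁)) * (x ^ 2 + (1 - x) * κ₂)) * ((1 - x) * ((1 + x) * (a : ℝ) - ((b : ℝ) * κ₁ + (a : ℝ) * κ₂))) / (x ^ 2 * (a : ℝ) + (1 - x) * ((b : ℝ) * κ₁ + (a : ℝ) * κ₂)))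
      ≤ ((x ^ 2 + (1 - x) * κ₁) * (x ^ 2 + (1 - x) * κ₂)) := by
  have ha0 : (0 : ℝ) < (a : ℝ) := by exact_mod_cast Nat.lt_of_lt_of_le Nat.zero_lt_one ha
  have hb0 : (0 : ℝ) < (b : ℝ) := by exact_mod_cast Nat.lt_of_lt_of_le Nat.zero_lt_one hb
  have hG1 : 0 < x ^ 2 + (1 - x) * κ₁ := by nlinarith [mul_pos (sub_pos.2 hx1) hk0, pow_pos hx0 2]
  have hG1' : x ^ 2 + (1 - x) * κ₁ < 1 := by nlinarith [mul_lt_mul_of_pos_left hkx (sub_pos.2 hx1)]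
  have hG2 : 0 < x ^ 2 + (1 - x) * κ₂ := by nlinarith [mul_pos (sub_pos.2 hx1) hk20, pow_pos hx0 2]
  have hG2' : x ^ 2 + (1 - x) * κ₂ < 1 := by nlinarith [mul_lt_mul_of_pos_left hk2x (sub_pos.2 hx1)]
  have hT0 : 0 < (b : ℝ) * κ₁ + (a : ℝ) * κ₂ := by nlinarith [mul_pos hb0 hk0, mul_pos ha0 hk20]
  have hsT : (b : ℝ) * κ₁ + (a : ℝ) * κ₂ < (b : ℝ) + (a : ℝ) := by
    nlinarith [mul_pos hb0 (sub_pos.2 (hkx.trans hx1)), mul_pos ha0 (sub_pos.2 (hk2x.trans hx1))]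
  have hL0n : (b : ℝ) * κ₁ + (a : ℝ) * κ₂ ≤ x * ((a : ℝ) + (b : ℝ)) := by
    nlinarith [mul_le_mul_of_nonneg_left hkx.le hb0.le, mul_le_mul_of_nonneg_left hk2x.le ha0.le]
  have hL0 : (b : ℝ) * κ₁ + (a : ℝ) * κ₂ ≤ x * ((b + a : ℕ) : ℝ) := by push_cast; linarith
  have hbaj : b + a ≤ j'' := by omega
  have hd0 : (0:ℝ) < (1 - x) * ((1 + x) * ((b : ℝ) + (a : ℝ)) - ((b : ℝ) * κ₁ + (a : ℝ) * κ₂)) := by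
    apply mul_pos (sub_pos.2 hx1); nlinarith [mul_nonneg hx0.le (by linarith : (0:ℝ) ≤ (b : ℝ) + (a : ℝ))]
  have hL1n : (b : ℝ) * κ₁ + (a : ℝ) * κ₂ - 2 * (b : ℝ) ≤ x * (a : ℝ) := by
    nlinarith [mul_le_mul_of_nonneg_left hk2x.le ha0.le, mul_nonneg hb0.le (by linarith : (0:ℝ) ≤ 2 - κ₁)]
  have hL1 : (b : ℝ) * κ₁ + (a : ℝ) * κ₂ - 2 * (b : ℝ) ≤ x * (((b + a : ℕ) : ℝ) - (b : ℝ)) := by push_cast; linarith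
  rw [usage_eq_light' x _ j'' b (b + a) hx0 hx1 hbaj h2b (by push_cast; linarith) hL1,
    usage0_eq_light x _ j'' (b + a) hx0 hx1 hbaj hT0 (by push_cast; linarith) hL0]
  push_cast
  have hd1 : (0:ℝ) < (1 - x) * ((1 - x) * (b : ℝ) + (1 + x) * ((b : ℝ) + (a : ℝ)) - ((b : ℝ) * κ₁ + (a : ℝ) * κ₂)) := by
    apply mul_pos (sub_pos.2 hx1); nlinarith [mul_nonneg hx0.le (by linarith : (0:ℝ) ≤ (b : ℝ) + (a : ℝ))]
  have hn1 : (0:ℝ) ≤ x ^ 2 * (a : ℝ) + (1 - x) * ((b : ℝ) * κ₁ + (a : ℝ) * κ₂ - 2 * (b : ℝ)) := by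
    nlinarith [mul_nonneg (pow_nonneg hx0.le 2) ha0.le, mul_nonneg (sub_nonneg.2 hx1.le) (sub_nonneg.2 h2b.le)]
  have hFd : (0:ℝ) < x ^ 2 * (a : ℝ) + (1 - x) * ((b : ℝ) * κ₁ + (a : ℝ) * κ₂) := by nlinarith [mul_pos (pow_pos hx0 2) ha0]
  have key := LightLightCert.poly_Z_L x κ₁ κ₂ a b ha0.le hb0.le (by linarith) (by linarith) (by linarith [hG1.le]) (by linarith) (by linarith [hG2.le]) (by linarith) hk0.le hx0.le
  rw [div_mul_eq_mul_div, sub_div' hFd.ne', div_mul_div_comm, div_add_div _ _ hd1.ne' (mul_ne_zero hd0.ne' hFd.ne'),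
    div_le_iff₀ (mul_pos hd1 (mul_pos hd0 hFd))]
  linarith [mul_nonneg (sub_nonneg.2 hx1.le) (mul_nonneg (sub_nonneg.2 hx1.le) (mul_nonneg hb0.le (mul_nonneg ha0.le (key))))]

end LawDec

end Quant

end Summit.CriticalPhenomena.PercolationContinuityZ3.Theorems
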